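/-
Copyright (c) 2026 the pub-hodgecm-mathlib formalisation cell (harness21).  Prover seat hodgecm-mathlib-LH4-p02 (g2): line LH4, Shalika pay-down organ «DUAL»
(LH4-plan (g2) dealer words #3 (b), 2026-09-02); skeleton cand `StubN6nsShalika.paydown.skeleton.v1` a42538b59ca1b043 `stub_ShDual` :131–:153 VERBATIM.
-/
import Literature.NumberTheory.Rogawski1990.UnipotentOrbitalIntegralLevelPiecesCM                 -- ★ RANK (unramified): `exists_levelPieces_det_classOrbitalIntegral_ne_zero`
import Literature.NumberTheory.Rogawski1990.UnipotentOrbitalIntegralLevelPiecesRamifiedCM         -- ★ RANK (tame ramified, level 2): `exists_levelPieces_det_classOrbitalIntegral_ne_zero_ramified`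
import Literature.NumberTheory.Rogawski1990.ShalikaGermExpansionHoweReduction                    -- ★ p848172 SH-3: `exists_dualPieces_total_of_subtype` (the `↥S`-Kronecker → total adapter)
import Literature.NumberTheory.Automorphic.OrbitalIntegralDualPieces                               -- ★ p848130: `exists_dualPieces_of_det_ne_zero` (RANK ⇒ DUAL by matrix inversion)
import Literature.NumberTheory.Rogawski1990.UnitaryVertexStabilizerSpanSelfDualTameRamifiedCM     -- ★ `ramifiedBlock_adicCompletion` (uniformiser `ϖ` with `σ_w ϖ = −ϖ` at a tame place); brings ★ `isUnit_two_integer_iff_valued_eq_one`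
import Literature.NumberTheory.Rogawski1990.LocalTransferIdentityCoreThreeWaySplit                 -- ★ `ramificationIdx'_ne_one_of_not_isUnramifiedIn_of_subsingleton`, ★ `smul_placesOver_eq_of_subsingleton`
import Literature.NumberTheory.Automorphic.LocalUnitaryGroupCongr                                  -- ★ `antidiagOne_isHermitian`
import Literature.NumberTheory.Automorphic.LocalUnitaryIntegralLevel                               -- ★ `placeForm_antidiagOne`, `isUnit_placeForm_antidiagOne`, `unit_placeForm_antidiagOne_mem_glInt`
import Literature.NumberTheory.Automorphic.LocalHermitianFormSign                                  -- ★ `det_antidiagOne_three_map` (`det Φ₃ = −1`)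
import HarnessLib

/-!
# DUAL PIECES for the unipotent orbital integrals of `U(Φ₃)(L⁺_v)` at an ODD non-split place ([Rogawski1990] §8.1, proof of Prop. 8.1.1, p. 113 l. 1–6)

Topic `NumberTheory/Rogawski1990`; namespace `Literature.NumberTheory.Rogawski1990`.  THEOREMS ONLY (no definition, no instance, no notation, no named fact, no `sorry`).
Cell `pub/hodgecm-mathlib` (D-0151), crux H413 = `stmt-HodgeConjecture-24833`, line LH4 (closer stub `stub_N6ns`; narrowed PRINT row `stub_N6nsShalika :
N6nsShalikaOddStatement` after ED. 39), Shalika pay-down organ **«DUAL»** — the text of `stub_ShDual` of the LH4 pay-down skeleton cand `StubN6nsShalika.paydown.skeleton.v1`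
(LH4-plan (g2), a42538b59ca1b043 :131–:153) VERBATIM, proved: for the quasi-split form `Φ₃ = antidiag(1,1,1)`, at a non-split place `v` (`Subsingleton (PlacesOver L v)`) with
`2 ∈ 𝒪_w^×` (odd residue characteristic), for EVERY finite set `S` of unipotent classes of `G = U(Φ₃)(L⁺_v)` and EVERY orbital-measure family `mU` admissible on `S`
with the Ranga-Rao integrability clause, there are dual pieces `fd u ∈ C_c^∞(G)` (`u ∈ S`): `Φ_{mU}(u, fd u) = 1`, `Φ_{mU}(u, fd u′) = 0` for `u ≠ u′`.

THE PROOF (★ glue, no new mathematics).  `c • w = w` for the place `w ∣ v` (★ `smul_placesOver_eq_of_subsingleton`); `Φ₃` is hermitian with good reduction at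
every place (★ `antidiagOne_isHermitian`, ★ `isUnit_placeForm_antidiagOne`, ★ `unit_placeForm_antidiagOne_mem_glInt`).  Split on `v` unramified ∕ ramified in `L`:
* UNRAMIFIED (`v` inert): ★ RANK `exists_levelPieces_det_classOrbitalIntegral_ne_zero` gives reference pieces `g_u ∈ C_c^∞` (`u ∈ S`) with `det (Φ(u, g_{u′})) ≠ 0`
  (the pieces `1_{K(2)}, 1_{K(1)∖K(2)}, 1_{K∖K(1)}, 1_R` by the class's type, triangular in the closure order);
* TAMELY RAMIFIED (`e(w|v) ≠ 1`, `2 ∈ 𝒪_w^×`): the ramified block ★ `ramifiedBlock_adicCompletion` supplies a uniformiser `ϖ_w` with `σ_w ϖ_w = −ϖ_w`; the integral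
  antidiagonal frame of `(Φ₃)_w` is the IDENTITY (`(Φ₃)_w = (−det Φ₃) • ᵗσ(1)·antidiag·1` since `det Φ₃ = −1`, ★ `det_antidiagOne_three_map`, ★ `placeForm_antidiagOne`);
  ★ RANK `exists_levelPieces_det_classOrbitalIntegral_ne_zero_ramified` gives the reference pieces;
then ★ p848130 `exists_dualPieces_of_det_ne_zero` inverts the matrix (`fd_u := Σ_i (M⁻¹)_{iu} g_i`, Kronecker duality on `↥S`) and ★ `exists_dualPieces_total_of_subtype` re-dresses
the `↥S`-indexed family as a total function with the three clauses of the organ.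

HONEST LABEL: count-neutral until the LH4 pay-down leaf is written and registered (the organ `stub_ShDual` of a HOME cand is paid HERE in ★ currency, by name-free text
identity); HC_CM is proved only modulo the 7 printed citations (2 remaining: hLiu418 = stmt-HodgeConjecture-24832, h413 = stmt-HodgeConjecture-24833) until rung 0 closes.

## References
* [Rogawski1990] J. D. Rogawski, *Automorphic Representations of Unitary Groups in Three Variables*, Ann. of Math. Stud. 123 (1990): §8.1, proof of Prop. 8.1.1 p. 113 (l. 1–6:
  «let `f_j ∈ C(G)` be such that `Φ(u_k, f_j) = δ_jk`»); §3.9 Prop. 3.9.1 p. 32 (unipotent classes); §4.9 p. 54.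
* [HarishChandra1999AdmissibleDistributions] Harish-Chandra (DeBacker–Sally), *Admissible Invariant Distributions on Reductive p-adic Groups*, ULS 16 (1999), §3.1 p. 17.
-/

set_option autoImplicit false

noncomputable section

open MeasureTheory Measure NumberField IsDedekindDomain Topology Filter
open Literature.MeasureTheory.Group Literature.NumberTheory.Automorphic Literature.NumberTheory.Automorphic.UnitaryGroup
open Literature.NumberTheory.GaloisRepresentations
open scoped Matrix MatrixGroups ValuativeRel

namespace Literature.NumberTheory.Rogawski1990

set_option maxHeartbeats 400000 in
-- statement-heavy: four instance binders (as the skeleton cand)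
/-- **ORGAN ‹DUAL› — dual pieces for the unipotent orbital integrals of `U(Φ₃)(L⁺_v)` at an ODD non-split place** (= `stub_ShDual` of the LH4 Shalika pay-down
skeleton cand a42538b59ca1b043 :131–:153, text verbatim): for every finite set `S` of unipotent classes and every orbital-measure family `mU` admissible on `S` with the
Ranga-Rao clause there are `fd u ∈ C_c^∞(G)` with `Φ_{mU}(u, fd u) = 1` and `Φ_{mU}(u, fd u′) = 0` (`u ≠ u′`).  Proof: ★ RANK (unramified ∕ tame ramified, frame `= 1` for
`Φ₃`) + ★ matrix inversion p848130 + ★ the total re-dress. [cite: Rogawski1990, §8.1 p. 113] [cite: HarishChandra1999AdmissibleDistributions, §3.1 p. 17] -/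
theorem UnitaryGroup.exists_unipotentDualPieces_antidiagOne_odd :
    ∀ (L : Type) [Field L] [NumberField L] [IsCMField L] (v : HeightOneSpectrum (𝓞 ↥(maximalRealSubfield L))) (w : UnitaryGroup.PlacesOver L v),
      Subsingleton (UnitaryGroup.PlacesOver L v) → IsUnit (2 : 𝒪[w.1.adicCompletion L]) →
      ∀ [MeasurableSpace ((cmDatum L 3 (Matrix.of fun i j : Fin 3 => if i.val + j.val + 1 = 3 then (1 : L) else 0)).Local v)] [BorelSpace ((cmDatum L 3 (Matrix.of fun i j : Fin 3 => if i.val + j.val + 1 = 3 then (1 : L) else 0)).Local v)]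
        [∀ γ : ((cmDatum L 3 (Matrix.of fun i j : Fin 3 => if i.val + j.val + 1 = 3 then (1 : L) else 0)).Local v), MeasurableSpace (((cmDatum L 3 (Matrix.of fun i j : Fin 3 => if i.val + j.val + 1 = 3 then (1 : L) else 0)).Local v) ⧸ Subgroup.centralizer ({γ} : Set ((cmDatum L 3 (Matrix.of fun i j : Fin 3 => if i.val + j.val + 1 = 3 then (1 : L) else 0)).Local v)))]
        [∀ γ : ((cmDatum L 3 (Matrix.of fun i j : Fin 3 => if i.val + j.val + 1 = 3 then (1 : L) else 0)).Local v), BorelSpace (((cmDatum L 3 (Matrix.of fun i j : Fin 3 => if i.val + j.val + 1 = 3 then (1 : L) else 0)).Local v) ⧸ Subgroup.centralizer ({γ} : Set ((cmDatum L 3 (Matrix.of fun i j : Fin 3 => if i.val + j.val + 1 = 3 then (1 : L) else 0)).Local v)))],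
      ∀ (S : Finset (ConjClasses ((cmDatum L 3 (Matrix.of fun i j : Fin 3 => if i.val + j.val + 1 = 3 then (1 : L) else 0)).Local v))) (mU : OrbitalMeasureFamily ((cmDatum L 3 (Matrix.of fun i j : Fin 3 => if i.val + j.val + 1 = 3 then (1 : L) else 0)).Local v)),
        (∀ u ∈ S, (((Quotient.out u : ((cmDatum L 3 (Matrix.of fun i j : Fin 3 => if i.val + j.val + 1 = 3 then (1 : L) else 0)).Local v)).val : GL (Fin 3) (UnitaryGroup.LocalRing L v)).val - 1) ^ 3 = 0) →
        mU.IsAdmissibleOn (fun γ : ((cmDatum L 3 (Matrix.of fun i j : Fin 3 => if i.val + j.val + 1 = 3 then (1 : L) else 0)).Local v) => (ConjClasses.mk γ) ∈ S) →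
        (∀ u ∈ S, ∀ f : ((cmDatum L 3 (Matrix.of fun i j : Fin 3 => if i.val + j.val + 1 = 3 then (1 : L) else 0)).Local v) → ℂ, IsLocSmooth f →
            Integrable (descConj (Quotient.out u : ((cmDatum L 3 (Matrix.of fun i j : Fin 3 => if i.val + j.val + 1 = 3 then (1 : L) else 0)).Local v)) (Subgroup.centralizer ({(Quotient.out u : ((cmDatum L 3 (Matrix.of fun i j : Fin 3 => if i.val + j.val + 1 = 3 then (1 : L) else 0)).Local v))} : Set ((cmDatum L 3 (Matrix.of fun i j : Fin 3 => if i.val + j.val + 1 = 3 then (1 : L) else 0)).Local v)))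
              (fun _ hg => Subgroup.mem_centralizer_singleton_iff.1 hg) f) (mU u)) →
        ∃ fd : ConjClasses ((cmDatum L 3 (Matrix.of fun i j : Fin 3 => if i.val + j.val + 1 = 3 then (1 : L) else 0)).Local v) → ((cmDatum L 3 (Matrix.of fun i j : Fin 3 => if i.val + j.val + 1 = 3 then (1 : L) else 0)).Local v) → ℂ,
          (∀ u ∈ S, IsLocSmooth (fd u)) ∧ (∀ u ∈ S, classOrbitalIntegral mU (fd u) u = 1) ∧
          (∀ u ∈ S, ∀ u' ∈ S, u ≠ u' → classOrbitalIntegral mU (fd u') u = 0) := by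
  intro L _ _ _ v w hsub h2 _ _ _ _ S mU hS hmU hRao
  classical
  have hw : IsCMField.complexConj L • w.1 = w.1 := smul_placesOver_eq_of_subsingleton L v (IsCMField.complexConj L) hsub w
  -- `Φ₃` is hermitian with good reduction at `w`
  have hH' := antidiagOne_isHermitian L 3
  have hH'w := isUnit_placeForm_antidiagOne (E := L) 3 w.1
  have hH'i := unit_placeForm_antidiagOne_mem_glInt (E := L) 3 w.1
  -- the reference pieces with invertible orbital-integral matrix, by the type of the place
  obtain ⟨gref, hgs, hdet⟩ : ∃ gref : ↥S → ((cmDatum L 3 (Matrix.of fun i j : Fin 3 => if i.val + j.val + 1 = 3 then (1 : L) else 0)).Local v) → ℂ,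
      (∀ i, IsLocSmooth (gref i)) ∧ (Matrix.of fun u u' : ↥S => classOrbitalIntegral mU (gref u') u).det ≠ 0 := by
    by_cases hv : Algebra.IsUnramifiedIn (𝓞 L) v.asIdeal
    · obtain ⟨gref, hgs, -, -, -, hdet⟩ :=
        exists_levelPieces_det_classOrbitalIntegral_ne_zero L _ hH' w hw hv hH'w hH'i h2 S hS mU hmU hRao
      exact ⟨gref, hgs, hdet⟩
    · have he : v.asIdeal.ramificationIdx' w.1.asIdeal ≠ 1 := ramificationIdx'_ne_one_of_not_isUnramifiedIn_of_subsingleton L hsub w hv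
      have hv2 : Valued.v (2 : w.1.adicCompletion L) = 1 := (isUnit_two_integer_iff_valued_eq_one (L := L) w.1).1 h2
      obtain ⟨ϖ, hϖ, hσϖ, -, -⟩ := ramifiedBlock_adicCompletion L v w hw he hv2
      -- the integral antidiagonal frame of `(Φ₃)_w` is the identity: `(Φ₃)_w = (−det (Φ₃)_w) • ᵗσ(1) · antidiag · 1`
      have hframe : placeForm (Matrix.of fun i j : Fin 3 => if i.val + j.val + 1 = 3 then (1 : L) else 0) w.1 =
          (-(placeForm (Matrix.of fun i j : Fin 3 => if i.val + j.val + 1 = 3 then (1 : L) else 0) w.1).det) •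
            formCongr (galAdicCompletionMap (L := L) (IsCMField.complexConj L) hw) (1 : GL (Fin 3) (w.1.adicCompletion L))
              ((StdForm.antidiagonal 3).over (w.1.adicCompletion L)) := by
        have hdet : (placeForm (Matrix.of fun i j : Fin 3 => if i.val + j.val + 1 = 3 then (1 : L) else 0) w.1).det = -1 := by
          exact det_antidiagOne_three_map L (algebraMap L (w.1.adicCompletion L))
        rw [hdet, neg_neg, one_smul, placeForm_antidiagOne]
        simp [formCongr, Matrix.map_one]
      obtain ⟨gref, hgs, -, -, -, hdet⟩ :=
        exists_levelPieces_det_classOrbitalIntegral_ne_zero_ramified L _ hH' w hw he hH'w hH'i h2 ϖ hϖ hσϖ 1 (Subgroup.one_mem _) hframe S hS mU hmU hRao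
      exact ⟨gref, hgs, hdet⟩
  -- invert: Kronecker dual pieces on `↥S`, then the total dress
  obtain ⟨fdS, hfdS, hkron, -⟩ := exists_dualPieces_of_det_ne_zero S mU hRao gref hgs hdet
  exact exists_dualPieces_total_of_subtype S mU fdS hfdS (fun u => by simpa using hkron u u)
    (fun u u' hne => by simpa [if_neg hne] using hkron u u')

end Literature.NumberTheory.Rogawski1990

end
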